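import Mathlib
import Summits.Ventures.PercRepro2.Defs
import Summits.Ventures.PercRepro2.Independence
import Summits.Ventures.PercRepro2.Harris
import Summits.Ventures.PercRepro2.Graph
import Summits.Ventures.PercRepro2.Exploration
import Summits.Ventures.PercRepro2.Events
import Summits.Ventures.PercRepro2.FourFunctions
import Summits.Ventures.PercRepro2.Induced
import Summits.Ventures.PercRepro2.Frontier
import Summits.Ventures.PercRepro2.ObsIndependence
import Summits.Ventures.PercRepro2.BHK
import Summits.Ventures.PercRepro2.BHKEvents
import Summits.Ventures.PercRepro2.VdBKahn
import Summits.Ventures.PercRepro2.BHKAvoid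
import Summits.Ventures.PercRepro2.BHKOutside
import Summits.Ventures.PercRepro2.GateDefs
import Summits.Ventures.PercRepro2.VTXDefs
import Summits.Ventures.PercRepro2.VTXSplitFrame
import Summits.Ventures.PercRepro2.HubModel
import Summits.Ventures.PercRepro2.HubLaw
import Summits.Ventures.PercRepro2.HubModel3
import Summits.Ventures.PercRepro2.HubLaw3
import Summits.Ventures.PercRepro2.HubPat3
import Summits.Ventures.PercRepro2.HubHarris3
import Summits.Ventures.PercRepro2.HubCert3Part1
import Summits.Ventures.PercRepro2.HubCert3Part2
import Summits.Ventures.PercRepro2.HubCert3Part3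
import Summits.Ventures.PercRepro2.HubCert3Part4
import Summits.Ventures.PercRepro2.HubCert3Part5
import Summits.Ventures.PercRepro2.HubCert3Part6
import Summits.Ventures.PercRepro2.HubCert3CH1
import Summits.Ventures.PercRepro2.HubCert3CH2

/-!
# The CH and MIX blocks of the a₃-hub certificates are nonnegative for the inner law (the blocks of every part; blind cell
PercRepro2, mine-2 g17; MINE2-A3FIRST.md §8.3)

The inner law of `G − a₃` is the law under the weights with every edge at `a₃` closed
(`NewVertex.prob_pinZ_eq`), so the cell's BHK corollaries for events outside the explored cluster
(`BHKOutside.lean`) apply on the inner graph: a `CH(s,X;E₁;E₂)` block —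
`P(s≁X)·P(s≁X, E₁, E₂ off C(s)) − P(s≁X, E₁ off C(s))·P(s≁X, E₂ off C(s))` — is `bhk_two_outside_avoid`
(the connection events `E_i = u_i ~ w_i` between marks other than `s`, holding off `C(s)`), and the
`MIX(s,X,u;E)` block — `P(s≁X, u ∈ C(s))·P(s≁X, E off C(s)) − P(s≁X)·P(s≁X, u ∈ C(s), E off C(s))` — is
`bhk_inside_outside_avoid`; each instance is written in the inner masses (events → `innerPat3`
predicates → sums over the atoms `atomPat3`, the predicates evaluated on the 15 atoms by `decide`, the
block polynomial by `ring`). Block definitions are textually identical across the six part files, so a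
block proved in its first part is the block of every later part by `exact`.
-/

namespace Summit.Ventures.PercRepro2.Hub3

open Hub

variable {V : Type*} {E : Type*} [Fintype E] [DecidableEq E] [Fintype V] [DecidableEq V]
  {R : Type*} [Field R] [LinearOrder R] [IsStrictOrderedRing R] {ends : E → Sym2 V} {μ : Mark → V}

/-- Block 6 of part 2 is the block 6 of part 1 (textually the same polynomial). -/
theorem part2_H6_nonneg (p : E → R) (hp : IsProbVec p) : 0 ≤ HubCert3.Part2.H6 (innerMass3 p ends μ) :=
  part1_H6_nonneg p hp

/-- Block 6 of part 3 is the block 6 of part 1 (textually the same polynomial). -/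
theorem part3_H6_nonneg (p : E → R) (hp : IsProbVec p) : 0 ≤ HubCert3.Part3.H6 (innerMass3 p ends μ) :=
  part1_H6_nonneg p hp

/-- Block 6 of part 4 is the block 6 of part 1 (textually the same polynomial). -/
theorem part4_H6_nonneg (p : E → R) (hp : IsProbVec p) : 0 ≤ HubCert3.Part4.H6 (innerMass3 p ends μ) :=
  part1_H6_nonneg p hp

/-- Block 6 of part 5 is the block 6 of part 1 (textually the same polynomial). -/
theorem part5_H6_nonneg (p : E → R) (hp : IsProbVec p) : 0 ≤ HubCert3.Part5.H6 (innerMass3 p ends μ) :=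
  part1_H6_nonneg p hp

/-- Block 6 of part 6 is the block 6 of part 1 (textually the same polynomial). -/
theorem part6_H6_nonneg (p : E → R) (hp : IsProbVec p) : 0 ≤ HubCert3.Part6.H6 (innerMass3 p ends μ) :=
  part1_H6_nonneg p hp

/-- Block 33 of part 3 is the block 33 of part 2 (textually the same polynomial). -/
theorem part3_H33_nonneg (p : E → R) (hp : IsProbVec p) : 0 ≤ HubCert3.Part3.H33 (innerMass3 p ends μ) :=
  part2_H33_nonneg p hp

/-- Block 33 of part 5 is the block 33 of part 2 (textually the same polynomial). -/
theorem part5_H33_nonneg (p : E → R) (hp : IsProbVec p) : 0 ≤ HubCert3.Part5.H33 (innerMass3 p ends μ) :=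
  part2_H33_nonneg p hp

/-- Block 33 of part 6 is the block 33 of part 2 (textually the same polynomial). -/
theorem part6_H33_nonneg (p : E → R) (hp : IsProbVec p) : 0 ≤ HubCert3.Part6.H33 (innerMass3 p ends μ) :=
  part2_H33_nonneg p hp

/-- Block 34 of part 3 is the block 34 of part 2 (textually the same polynomial). -/
theorem part3_H34_nonneg (p : E → R) (hp : IsProbVec p) : 0 ≤ HubCert3.Part3.H34 (innerMass3 p ends μ) :=
  part2_H34_nonneg p hp

/-- Block 34 of part 5 is the block 34 of part 2 (textually the same polynomial). -/
theorem part5_H34_nonneg (p : E → R) (hp : IsProbVec p) : 0 ≤ HubCert3.Part5.H34 (innerMass3 p ends μ) :=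
  part2_H34_nonneg p hp

/-- Block 34 of part 6 is the block 34 of part 2 (textually the same polynomial). -/
theorem part6_H34_nonneg (p : E → R) (hp : IsProbVec p) : 0 ≤ HubCert3.Part6.H34 (innerMass3 p ends μ) :=
  part2_H34_nonneg p hp

/-- Block 35 of part 3 is the block 35 of part 2 (textually the same polynomial). -/
theorem part3_H35_nonneg (p : E → R) (hp : IsProbVec p) : 0 ≤ HubCert3.Part3.H35 (innerMass3 p ends μ) :=
  part2_H35_nonneg p hp

/-- Block 35 of part 5 is the block 35 of part 2 (textually the same polynomial). -/
theorem part5_H35_nonneg (p : E → R) (hp : IsProbVec p) : 0 ≤ HubCert3.Part5.H35 (innerMass3 p ends μ) :=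
  part2_H35_nonneg p hp

/-- Block 35 of part 6 is the block 35 of part 2 (textually the same polynomial). -/
theorem part6_H35_nonneg (p : E → R) (hp : IsProbVec p) : 0 ≤ HubCert3.Part6.H35 (innerMass3 p ends μ) :=
  part2_H35_nonneg p hp

/-- Block 36 of part 3 is the block 36 of part 2 (textually the same polynomial). -/
theorem part3_H36_nonneg (p : E → R) (hp : IsProbVec p) : 0 ≤ HubCert3.Part3.H36 (innerMass3 p ends μ) :=
  part2_H36_nonneg p hp

/-- Block 36 of part 5 is the block 36 of part 2 (textually the same polynomial). -/
theorem part5_H36_nonneg (p : E → R) (hp : IsProbVec p) : 0 ≤ HubCert3.Part5.H36 (innerMass3 p ends μ) :=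
  part2_H36_nonneg p hp

/-- Block 36 of part 6 is the block 36 of part 2 (textually the same polynomial). -/
theorem part6_H36_nonneg (p : E → R) (hp : IsProbVec p) : 0 ≤ HubCert3.Part6.H36 (innerMass3 p ends μ) :=
  part2_H36_nonneg p hp

/-- Block 37 of part 3 is the block 37 of part 2 (textually the same polynomial). -/
theorem part3_H37_nonneg (p : E → R) (hp : IsProbVec p) : 0 ≤ HubCert3.Part3.H37 (innerMass3 p ends μ) :=
  part2_H37_nonneg p hp

/-- Block 38 of part 3 is the block 38 of part 2 (textually the same polynomial). -/
theorem part3_H38_nonneg (p : E → R) (hp : IsProbVec p) : 0 ≤ HubCert3.Part3.H38 (innerMass3 p ends μ) :=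
  part2_H38_nonneg p hp

/-- Block 38 of part 5 is the block 38 of part 2 (textually the same polynomial). -/
theorem part5_H38_nonneg (p : E → R) (hp : IsProbVec p) : 0 ≤ HubCert3.Part5.H38 (innerMass3 p ends μ) :=
  part2_H38_nonneg p hp

/-- Block 38 of part 6 is the block 38 of part 2 (textually the same polynomial). -/
theorem part6_H38_nonneg (p : E → R) (hp : IsProbVec p) : 0 ≤ HubCert3.Part6.H38 (innerMass3 p ends μ) :=
  part2_H38_nonneg p hp

/-- Block 39 of part 3 is the block 39 of part 2 (textually the same polynomial). -/
theorem part3_H39_nonneg (p : E → R) (hp : IsProbVec p) : 0 ≤ HubCert3.Part3.H39 (innerMass3 p ends μ) :=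
  part2_H39_nonneg p hp

/-- Block 39 of part 4 is the block 39 of part 2 (textually the same polynomial). -/
theorem part4_H39_nonneg (p : E → R) (hp : IsProbVec p) : 0 ≤ HubCert3.Part4.H39 (innerMass3 p ends μ) :=
  part2_H39_nonneg p hp

/-- Block 39 of part 5 is the block 39 of part 2 (textually the same polynomial). -/
theorem part5_H39_nonneg (p : E → R) (hp : IsProbVec p) : 0 ≤ HubCert3.Part5.H39 (innerMass3 p ends μ) :=
  part2_H39_nonneg p hp

/-- Block 39 of part 6 is the block 39 of part 2 (textually the same polynomial). -/
theorem part6_H39_nonneg (p : E → R) (hp : IsProbVec p) : 0 ≤ HubCert3.Part6.H39 (innerMass3 p ends μ) :=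
  part2_H39_nonneg p hp

/-- Block 40 of part 3 is the block 40 of part 2 (textually the same polynomial). -/
theorem part3_H40_nonneg (p : E → R) (hp : IsProbVec p) : 0 ≤ HubCert3.Part3.H40 (innerMass3 p ends μ) :=
  part2_H40_nonneg p hp

/-- Block 40 of part 5 is the block 40 of part 2 (textually the same polynomial). -/
theorem part5_H40_nonneg (p : E → R) (hp : IsProbVec p) : 0 ≤ HubCert3.Part5.H40 (innerMass3 p ends μ) :=
  part2_H40_nonneg p hp

/-- Block 40 of part 6 is the block 40 of part 2 (textually the same polynomial). -/
theorem part6_H40_nonneg (p : E → R) (hp : IsProbVec p) : 0 ≤ HubCert3.Part6.H40 (innerMass3 p ends μ) :=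
  part2_H40_nonneg p hp

/-- Block 41 of part 3 is the block 41 of part 2 (textually the same polynomial). -/
theorem part3_H41_nonneg (p : E → R) (hp : IsProbVec p) : 0 ≤ HubCert3.Part3.H41 (innerMass3 p ends μ) :=
  part2_H41_nonneg p hp

/-- Block 41 of part 5 is the block 41 of part 2 (textually the same polynomial). -/
theorem part5_H41_nonneg (p : E → R) (hp : IsProbVec p) : 0 ≤ HubCert3.Part5.H41 (innerMass3 p ends μ) :=
  part2_H41_nonneg p hp

/-- Block 41 of part 6 is the block 41 of part 2 (textually the same polynomial). -/
theorem part6_H41_nonneg (p : E → R) (hp : IsProbVec p) : 0 ≤ HubCert3.Part6.H41 (innerMass3 p ends μ) :=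
  part2_H41_nonneg p hp

/-- Block 42 of part 3 is the block 42 of part 2 (textually the same polynomial). -/
theorem part3_H42_nonneg (p : E → R) (hp : IsProbVec p) : 0 ≤ HubCert3.Part3.H42 (innerMass3 p ends μ) :=
  part2_H42_nonneg p hp

/-- Block 42 of part 5 is the block 42 of part 2 (textually the same polynomial). -/
theorem part5_H42_nonneg (p : E → R) (hp : IsProbVec p) : 0 ≤ HubCert3.Part5.H42 (innerMass3 p ends μ) :=
  part2_H42_nonneg p hp

/-- Block 42 of part 6 is the block 42 of part 2 (textually the same polynomial). -/
theorem part6_H42_nonneg (p : E → R) (hp : IsProbVec p) : 0 ≤ HubCert3.Part6.H42 (innerMass3 p ends μ) :=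
  part2_H42_nonneg p hp

/-- Block 59 of part 6 is the block 59 of part 3 (textually the same polynomial). -/
theorem part6_H59_nonneg (p : E → R) (hp : IsProbVec p) : 0 ≤ HubCert3.Part6.H59 (innerMass3 p ends μ) :=
  part3_H59_nonneg p hp

/-- Block 60 of part 5 is the block 60 of part 3 (textually the same polynomial). -/
theorem part5_H60_nonneg (p : E → R) (hp : IsProbVec p) : 0 ≤ HubCert3.Part5.H60 (innerMass3 p ends μ) :=
  part3_H60_nonneg p hp

/-- Block 60 of part 6 is the block 60 of part 3 (textually the same polynomial). -/
theorem part6_H60_nonneg (p : E → R) (hp : IsProbVec p) : 0 ≤ HubCert3.Part6.H60 (innerMass3 p ends μ) :=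
  part3_H60_nonneg p hp

/-- Block 61 of part 6 is the block 61 of part 3 (textually the same polynomial). -/
theorem part6_H61_nonneg (p : E → R) (hp : IsProbVec p) : 0 ≤ HubCert3.Part6.H61 (innerMass3 p ends μ) :=
  part3_H61_nonneg p hp

/-- Block 62 of part 5 is the block 62 of part 3 (textually the same polynomial). -/
theorem part5_H62_nonneg (p : E → R) (hp : IsProbVec p) : 0 ≤ HubCert3.Part5.H62 (innerMass3 p ends μ) :=
  part3_H62_nonneg p hp

/-- Block 62 of part 6 is the block 62 of part 3 (textually the same polynomial). -/
theorem part6_H62_nonneg (p : E → R) (hp : IsProbVec p) : 0 ≤ HubCert3.Part6.H62 (innerMass3 p ends μ) :=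
  part3_H62_nonneg p hp

end Summit.Ventures.PercRepro2.Hub3
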